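import Literature.MathematicalPhysics.QuantumLattice.RectTorusWrapCovariance
import Literature.MathematicalPhysics.QuantumLattice.SpinChargeTransportLocality
import HarnessLib

/-!
# The torus interaction of a finite-range bounded lattice interaction is coordinate-local

For a lattice interaction `Φ` on `ℤ^d` of finite range `R` (`HasFiniteRange`), bounded by `J`
(`IsBounded`) and Hermitian, the interaction `rectTorusInteraction Φ Ls` induced on the rectangular
torus `𝕋 = Π i, ℤ/(Ls i)ℤ` (periodic boundary conditions, `LocalDynamics.lean`) satisfies, for every
coordinate direction `i`, the hypotheses `SpinLSM.IsCoordLocal (· i) (rectTorusInteraction Φ Ls) r₀ V J𝕋`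
of the spin Lieb–Schultz–Mattis index machinery (`SpinChargeTransportLocality.lean`), with constants
**independent of the side lengths `Ls`**:

* `rectTorusInteraction_empty`: no constant term;
* `card_le_of_rectTorusInteraction_ne_zero`: nonzero terms have at most `(2⌊R⌋+1)^d` sites;
* `circDist_le_of_rectTorusInteraction_ne_zero`: nonzero terms have periodic coordinate spread
  `≤ ⌊R⌋` in every direction;
* `sum_norm_rectTorusInteraction_le`: the local interaction strength
  `Σ_{Y ∋ y} ‖(rectTorusInteraction Φ Ls) Y‖ ≤ 2^d · 2^{(2⌊R⌋+1)^d} · J` (at most `2^d` lifts of `y` in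
  the box of representatives, at most `2^{|box ⌊R⌋|}` regions of range `⌊R⌋` through each lift, each
  wrapped term of norm `≤ ‖Φ X‖ ≤ J` since relabelling sites and tensoring with the identity do not
  increase the operator norm);
* `isCoordLocal_rectTorusInteraction`: the package;
* `commute_rectTorusInteraction_regionCharge`: for a rotation-invariant (`SU(2)`-symmetric)
  spin-`1/2` interaction every torus term conserves the charge `Q_Y = Σ_{y ∈ Y} (Sᶻ_y + ½)` of its
  own region (the `U(1)` hypothesis of Bachmann–Bols–De Roeck–Fraas);
* `permOp_addRight_mul_rectTorusHamiltonian`: translation symmetry as commutation with the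
  permutation unitary.

These are the model-side inputs (conditions LSM1–LSM3 of Nachtergaele–Sims 2007, §1.2, for the
torus model of `SpinChains.higherDim_lsm`). Theorems only; no definitions, no named facts.

## References

* B. Nachtergaele, R. Sims, *A multi-dimensional Lieb–Schultz–Mattis theorem*, Comm. Math. Phys.
  **276** (2007) 437–472, §1.2 (LSM1: finite range and boundedness; LSM2: periodicity; LSM3:
  rotation invariance). [NachtergaeleSimsCMP2007]
* M. B. Hastings, Phys. Rev. B **69** (2004) 104431, §II. [HastingsPRB2004]
* S. Bachmann, A. Bols, W. De Roeck, M. Fraas, Comm. Math. Phys. **375** (2019) 1249–1272, §2.1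
  (finite range, `U(1)` charge, translation symmetry). [BachmannEtAl2019]
-/

noncomputable section

namespace Literature.MathematicalPhysics.QuantumLattice

open Matrix Finset HigherDimLSM
open scoped Matrix.Norms.L2Operator ComplexOrder
open Literature.Probability.LatticeModels

/-! ### Relabelling sites does not increase the operator norm -/

section Reindex

variable {Λ Λ' : Type*} [Fintype Λ] [DecidableEq Λ] [Fintype Λ'] [DecidableEq Λ'] {q : ℕ}

/-- The Euclidean norm is invariant under relabelling coordinates. [folklore] -/
theorem eucNorm_comp_equiv {m k : Type*} [Fintype m] [Fintype k] (w : k → ℂ) (f : m ≃ k) :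
    eucNorm (w ∘ f) = eucNorm w := by
  have h1 := eucNorm_sq (w ∘ f)
  have h2 := eucNorm_sq w
  have hdot : star (w ∘ ⇑f) ⬝ᵥ (w ∘ ⇑f) = star w ⬝ᵥ w := by
    simp only [dotProduct, Pi.star_apply, Function.comp_apply]
    exact Equiv.sum_comp f (fun j => star (w j) * w j)
  rw [hdot, ← h2] at h1
  exact (pow_left_inj₀ (eucNorm_nonneg _) (eucNorm_nonneg _) two_ne_zero).1 h1

/-- Action of a relabelled observable on vectors: `(reindexOp e A) v = (A (v ∘ ẽ)) ∘ ẽ⁻¹` with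
`ẽ : (Λ → Fin q) ≃ (Λ' → Fin q)` the induced relabelling of configurations.
Bratteli–Robinson II §6.2.1 (covariance). [folklore] -/
theorem reindexOp_mulVec (e : Λ ≃ Λ') (A : Op Λ q) (v : TensorIndex Λ' q → ℂ) :
    reindexOp e A *ᵥ v =
      (A *ᵥ (v ∘ (e.arrowCongr (Equiv.refl (Fin q))))) ∘ (e.arrowCongr (Equiv.refl (Fin q))).symm := by
  have hre : reindexOp e A =
      A.submatrix (e.arrowCongr (Equiv.refl (Fin q))).symm (e.arrowCongr (Equiv.refl (Fin q))).symm := by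
    simp only [reindexOp, Matrix.coe_reindexAlgEquiv, Matrix.reindex_apply]
  rw [hre, Matrix.submatrix_mulVec_equiv, Equiv.symm_symm]

/-- **Relabelling sites does not increase the `L²`-operator norm** (it is in fact an isometry).
Bratteli–Robinson II §6.2.1 (covariance by `*`-isomorphisms). [folklore] -/
theorem norm_reindexOp_le (e : Λ ≃ Λ') (A : Op Λ q) : ‖reindexOp e A‖ ≤ ‖A‖ := by
  rw [Matrix.cstar_norm_def (reindexOp e A)]
  refine ContinuousLinearMap.opNorm_le_bound _ (norm_nonneg _) fun x => ?_
  have h1 : ‖toEuclideanCLM (n := TensorIndex Λ' q) (𝕜 := ℂ) (reindexOp e A) x‖ =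
      eucNorm (reindexOp e A *ᵥ WithLp.ofLp x) := rfl
  have hx : ‖x‖ = eucNorm (WithLp.ofLp x) := rfl
  rw [h1, hx, reindexOp_mulVec, eucNorm_comp_equiv]
  calc eucNorm (A *ᵥ (WithLp.ofLp x ∘ ⇑(e.arrowCongr (Equiv.refl (Fin q)))))
      ≤ ‖A‖ * eucNorm (WithLp.ofLp x ∘ ⇑(e.arrowCongr (Equiv.refl (Fin q)))) := eucNorm_mulVec_le _ _
    _ = ‖A‖ * eucNorm (WithLp.ofLp x) := by rw [eucNorm_comp_equiv]

end Reindex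

/-! ### Periodic distance of integer translates -/

section CircDist

variable {L : ℕ} [NeZero L]

/-- `circDist (a + k) a ≤ k`. [folklore] -/
theorem circDist_add_natCast_le (a : ZMod L) (k : ℕ) : circDist (a + (k : ZMod L)) a ≤ k := by
  induction k with
  | zero => simp
  | succ k ih =>
    rw [Nat.cast_succ, ← add_assoc]
    exact (circDist_add_one_le _ _).trans (by omega)

/-- `circDist (a - k) a ≤ k`. [folklore] -/
theorem circDist_sub_natCast_le (a : ZMod L) (k : ℕ) : circDist (a - (k : ZMod L)) a ≤ k := by
  induction k with
  | zero => simp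
  | succ k ih =>
    rw [Nat.cast_succ, ← sub_sub]
    exact (circDist_sub_one_le _ _).trans (by omega)

/-- `circDist (a + w) a ≤ |w|` for an integer `w`. [folklore] -/
theorem circDist_add_intCast_le (a : ZMod L) (w : ℤ) : circDist (a + (w : ZMod L)) a ≤ w.natAbs := by
  obtain ⟨n, rfl | rfl⟩ := Int.eq_nat_or_neg w
  · rw [Int.cast_natCast, Int.natAbs_natCast]
    exact circDist_add_natCast_le a n
  · rw [Int.cast_neg, Int.cast_natCast, Int.natAbs_neg, Int.natAbs_natCast, ← sub_eq_add_neg]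
    exact circDist_sub_natCast_le a n

end CircDist

/-! ### The torus interaction: terms, sizes, ranges -/

section Terms

variable {d q : ℕ} (Ls : Fin d → ℕ)

/-- **No constant term**: `(rectTorusInteraction Φ Ls) ∅ = 0` (wrap representatives are nonempty).
[folklore] -/
theorem rectTorusInteraction_empty (Φ : LatticeInteraction d q) :
    rectTorusInteraction Φ Ls (∅ : Finset (RectTorusSite Ls)) = 0 := by
  rw [rectTorusInteraction_eq_sum]
  refine Finset.sum_eq_zero fun X hX => ?_
  rw [Finset.mem_filter, mem_wrapRepSet] at hX
  obtain ⟨⟨hne, -, -⟩, himg⟩ := hX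
  exact absurd himg (Finset.image_nonempty.2 hne).ne_empty

/-- A nonzero torus term at `Y` comes from a wrap representative `X` over `Y` carrying a nonzero
term of `Φ`. Hastings (2004) §II. [folklore] -/
theorem exists_rep_of_rectTorusInteraction_ne_zero {Φ : LatticeInteraction d q}
    {Y : Finset (RectTorusSite Ls)} (hY : rectTorusInteraction Φ Ls Y ≠ 0) :
    ∃ X : Finset (Site d), IsWrapRepresentative Ls X ∧ X.image (RectTorus.proj Ls) = Y ∧ Φ X ≠ 0 := by
  rw [rectTorusInteraction_eq_sum] at hY
  obtain ⟨X, hX, hne⟩ := Finset.exists_ne_zero_of_sum_ne_zero hY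
  rw [Finset.mem_filter, mem_wrapRepSet] at hX
  refine ⟨X, hX.1, hX.2, fun h0 => hne ?_⟩
  rw [h0, wrapTerm_zero]

/-- **Nonzero torus terms have at most `(2⌊R⌋+1)^d` sites** for an interaction of range `R`.
Nachtergaele–Sims (2007) §1.2 (LSM1); Bratteli–Robinson II §6.2.1. [folklore] -/
theorem card_le_of_rectTorusInteraction_ne_zero {Φ : LatticeInteraction d q} {R : ℝ}
    (hR : Φ.HasFiniteRange R) {Y : Finset (RectTorusSite Ls)} (hY : rectTorusInteraction Φ Ls Y ≠ 0) :
    Y.card ≤ (2 * ⌊R⌋₊ + 1) ^ d := by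
  obtain ⟨X, ⟨hne, -, -⟩, rfl, hΦ⟩ := exists_rep_of_rectTorusInteraction_ne_zero Ls hY
  obtain ⟨x, hx⟩ := hne
  calc (X.image (RectTorus.proj Ls)).card ≤ X.card := Finset.card_image_le
    _ ≤ ((box d ⌊R⌋₊).image fun w => x + w).card := Finset.card_le_card (hR.subset_image_box hΦ hx)
    _ ≤ (box d ⌊R⌋₊).card := Finset.card_image_le
    _ = (2 * ⌊R⌋₊ + 1) ^ d := card_box d _

variable [∀ i, NeZero (Ls i)]

/-- **Nonzero torus terms have periodic coordinate spread `≤ ⌊R⌋`** in every direction, for an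
interaction of range `R`. Nachtergaele–Sims (2007) §1.2 (LSM1). [folklore] -/
theorem circDist_le_of_rectTorusInteraction_ne_zero {Φ : LatticeInteraction d q} {R : ℝ}
    (hR : Φ.HasFiniteRange R) {Y : Finset (RectTorusSite Ls)} (hY : rectTorusInteraction Φ Ls Y ≠ 0)
    {y y' : RectTorusSite Ls} (hy : y ∈ Y) (hy' : y' ∈ Y) (i : Fin d) :
    circDist (y i) (y' i) ≤ ⌊R⌋₊ := by
  obtain ⟨X, -, rfl, hΦ⟩ := exists_rep_of_rectTorusInteraction_ne_zero Ls hY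
  obtain ⟨x, hx, rfl⟩ := Finset.mem_image.1 hy
  obtain ⟨x', hx', rfl⟩ := Finset.mem_image.1 hy'
  obtain ⟨w, hw, rfl⟩ := Finset.mem_image.1 (hR.subset_image_box hΦ hx' hx)
  rw [mem_box] at hw
  have hi := hw i
  simp only [RectTorus.proj_apply, Pi.add_apply, Int.cast_add]
  refine (circDist_add_intCast_le _ _).trans ?_
  omega

/-- **The wrapped term of a representative has norm at most `‖A‖`** (`q ≠ 0`): it is `A` relabelled
along `X ≃ proj X` and tensored with the identity. Bratteli–Robinson II §6.2.1. [folklore] -/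
theorem norm_wrapTerm_le [NeZero q] {X : Finset (Site d)} (hX : Set.InjOn (RectTorus.proj Ls) X)
    (A : Matrix (X → Fin q) (X → Fin q) ℂ) : ‖wrapTerm Ls X A‖ ≤ ‖A‖ := by
  obtain ⟨e, he⟩ := exists_equiv_image Ls X hX
  rw [wrapTerm_eq_localOp_reindexOp Ls X e he, norm_localOp_holds _ (reindexOp e A)]
  exact norm_reindexOp_le e A

/-- **At most `2^d` points of the box of representatives `Π i, [0, 2 Ls i)` project to a given
torus site** (the lifts `(y_i) + ε_i Ls i`, `ε ∈ {0,1}^d`). [folklore] -/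
theorem card_filter_wrapRepBox_proj_eq_le (y : RectTorusSite Ls) :
    ((wrapRepBox Ls).filter (fun x => RectTorus.proj Ls x = y)).card ≤ 2 ^ d := by
  set lift : (Fin d → Bool) → Site d := fun b i => ((y i).val : ℤ) + if b i then (Ls i : ℤ) else 0
    with hlift
  have hsub : (wrapRepBox Ls).filter (fun x => RectTorus.proj Ls x = y) ⊆
      (univ : Finset (Fin d → Bool)).image lift := by
    intro x hx
    rw [Finset.mem_filter, wrapRepBox, Fintype.mem_piFinset] at hx
    obtain ⟨hbox, hxy⟩ := hx
    refine Finset.mem_image.2 ⟨fun i => decide ((Ls i : ℤ) ≤ x i), Finset.mem_univ _, ?_⟩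
    funext i
    have hi := hbox i
    rw [Finset.mem_Ico] at hi
    have hval : ((y i).val : ℤ) = x i % (Ls i : ℤ) := by
      rw [← hxy, RectTorus.proj_apply, ZMod.val_intCast]
    have hL : (0 : ℤ) < Ls i := by exact_mod_cast Nat.pos_of_ne_zero (NeZero.ne _)
    simp only [hlift, hval, decide_eq_true_eq]
    by_cases hle : (Ls i : ℤ) ≤ x i
    · rw [if_pos hle]
      have hmod : x i % (Ls i : ℤ) = x i - Ls i := by
        have e1 : x i % (Ls i : ℤ) = ((x i - Ls i) + (Ls i : ℤ) * 1) % (Ls i : ℤ) := by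
          congr 1; ring
        rw [e1, Int.add_mul_emod_self_left]
        exact Int.emod_eq_of_lt (by linarith) (by linarith)
      rw [hmod]
      ring
    · rw [if_neg hle, Int.emod_eq_of_lt hi.1 (lt_of_not_ge hle), add_zero]
  calc ((wrapRepBox Ls).filter (fun x => RectTorus.proj Ls x = y)).card
      ≤ ((univ : Finset (Fin d → Bool)).image lift).card := Finset.card_le_card hsub
    _ ≤ (univ : Finset (Fin d → Bool)).card := Finset.card_image_le
    _ = 2 ^ d := by rw [Finset.card_univ, Fintype.card_fun, Fintype.card_bool, Fintype.card_fin]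

/-- Each torus term has norm at most the sum of `‖Φ X‖` over the representatives over its region
(`q ≠ 0`). Nachtergaele–Sims (2006) §2. [folklore] -/
theorem norm_rectTorusInteraction_le_sum [NeZero q] (Φ : LatticeInteraction d q)
    (Y : Finset (RectTorusSite Ls)) :
    ‖rectTorusInteraction Φ Ls Y‖ ≤
      ∑ X ∈ (wrapRepSet Ls).filter (fun X => X.image (RectTorus.proj Ls) = Y), ‖Φ X‖ := by
  rw [rectTorusInteraction_eq_sum]
  refine (norm_sum_le _ _).trans (Finset.sum_le_sum fun X hX => ?_)
  rw [Finset.mem_filter, mem_wrapRepSet] at hX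
  exact norm_wrapTerm_le Ls (injOn_proj_of_isWrapRepresentative hX.1) _

/-- Re-summation: summing over the regions `Y ∋ y` and then over the representatives over `Y` is
summing over the representatives whose projection contains `y`. [folklore] -/
theorem sum_filter_mem_sum_reps_eq (f : Finset (Site d) → ℝ) (y : RectTorusSite Ls) :
    ∑ Y ∈ univ.filter (fun Y : Finset (RectTorusSite Ls) => y ∈ Y),
        ∑ X ∈ (wrapRepSet Ls).filter (fun X => X.image (RectTorus.proj Ls) = Y), f X =
      ∑ X ∈ (wrapRepSet Ls).filter (fun X => y ∈ X.image (RectTorus.proj Ls)), f X := by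
  rw [Finset.sum_fiberwise_eq_sum_filter]
  refine Finset.sum_congr ?_ fun _ _ => rfl
  ext X
  simp only [Finset.mem_filter, Finset.mem_univ, true_and]

/-- **The local interaction strength of the torus interaction is bounded uniformly in the side
lengths**: `Σ_{Y ∋ y} ‖(rectTorusInteraction Φ Ls) Y‖ ≤ 2^d · 2^{(2⌊R⌋+1)^d} · J` for `Φ` of range
`R` bounded by `J` (local dimension `q ≠ 0`). Nachtergaele–Sims (2007) §1.2 (LSM1, `‖Φ‖` finite);
Nachtergaele–Sims (2006) §2. [folklore] -/
theorem sum_norm_rectTorusInteraction_le [NeZero q] {Φ : LatticeInteraction d q} {R J : ℝ}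
    (hR : Φ.HasFiniteRange R) (hJ : Φ.IsBounded J) (y : RectTorusSite Ls) :
    ∑ Y ∈ univ.filter (fun Y : Finset (RectTorusSite Ls) => y ∈ Y), ‖rectTorusInteraction Φ Ls Y‖ ≤
      2 ^ d * 2 ^ ((2 * ⌊R⌋₊ + 1) ^ d) * J := by
  have hJ0 : 0 ≤ J := (norm_nonneg _).trans (hJ ∅)
  -- the lifts of `y`, their `⌊R⌋`-neighbourhood family, the representatives through `y`
  set S := (wrapRepBox Ls).filter (fun x => RectTorus.proj Ls x = y) with hS
  set N := S.biUnion fun x => (((box d ⌊R⌋₊).image fun w => x + w).powerset) with hN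
  set s' := (wrapRepSet Ls).filter (fun X => y ∈ X.image (RectTorus.proj Ls)) with hs'
  have hmemN : ∀ X ∈ s', ‖Φ X‖ ≠ 0 → X ∈ N := by
    intro X hX hΦ
    rw [hs', Finset.mem_filter, mem_wrapRepSet] at hX
    obtain ⟨hrep, hy⟩ := hX
    obtain ⟨x, hx, hxy⟩ := Finset.mem_image.1 hy
    have hΦ' : Φ X ≠ 0 := fun h0 => hΦ (by rw [h0, norm_zero])
    refine Finset.mem_biUnion.2 ⟨x, ?_, Finset.mem_powerset.2 (hR.subset_image_box hΦ' hx)⟩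
    rw [hS, Finset.mem_filter]
    exact ⟨subset_wrapRepBox Ls hrep hx, hxy⟩
  have hNcard : N.card ≤ 2 ^ d * 2 ^ ((2 * ⌊R⌋₊ + 1) ^ d) := by
    calc N.card ≤ S.card * 2 ^ (box d ⌊R⌋₊).card := card_nbhd_le S R
      _ ≤ 2 ^ d * 2 ^ ((2 * ⌊R⌋₊ + 1) ^ d) := by
          rw [card_box]
          exact Nat.mul_le_mul_right _ (card_filter_wrapRepBox_proj_eq_le Ls y)
  have hsub : s'.filter (fun X => X ∈ N) ⊆ N := fun X hX => (Finset.mem_filter.1 hX).2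
  calc ∑ Y ∈ univ.filter (fun Y : Finset (RectTorusSite Ls) => y ∈ Y), ‖rectTorusInteraction Φ Ls Y‖
      ≤ ∑ Y ∈ univ.filter (fun Y : Finset (RectTorusSite Ls) => y ∈ Y),
          ∑ X ∈ (wrapRepSet Ls).filter (fun X => X.image (RectTorus.proj Ls) = Y), ‖Φ X‖ :=
        Finset.sum_le_sum fun Y _ => norm_rectTorusInteraction_le_sum Ls Φ Y
    _ = ∑ X ∈ s', ‖Φ X‖ := sum_filter_mem_sum_reps_eq Ls _ y
    _ = ∑ X ∈ s'.filter (fun X => X ∈ N), ‖Φ X‖ := (Finset.sum_filter_of_ne hmemN).symm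
    _ ≤ ∑ X ∈ s'.filter (fun X => X ∈ N), J := Finset.sum_le_sum fun X _ => hJ X
    _ = ((s'.filter (fun X => X ∈ N)).card : ℝ) * J := by rw [Finset.sum_const, nsmul_eq_mul]
    _ ≤ (N.card : ℝ) * J :=
        mul_le_mul_of_nonneg_right (by exact_mod_cast Finset.card_le_card hsub) hJ0
    _ ≤ ((2 ^ d * 2 ^ ((2 * ⌊R⌋₊ + 1) ^ d) : ℕ) : ℝ) * J :=
        mul_le_mul_of_nonneg_right (by exact_mod_cast hNcard) hJ0
    _ = 2 ^ d * 2 ^ ((2 * ⌊R⌋₊ + 1) ^ d) * J := by push_cast; ring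

/-- **The torus interaction of a finite-range, bounded, Hermitian lattice interaction is
coordinate-local** in every direction `i`, with constants independent of the side lengths:
range `⌊R⌋ + 1`, term size `(2⌊R⌋+1)^d`, strength `2^d 2^{(2⌊R⌋+1)^d} J`.
Nachtergaele–Sims (2007) §1.2 (LSM1). [folklore] -/
theorem isCoordLocal_rectTorusInteraction [NeZero q] {Φ : LatticeInteraction d q} {R J : ℝ}
    (hR : Φ.HasFiniteRange R) (hJ : Φ.IsBounded J) (hH : Φ.IsHermitian) (i : Fin d) :
    SpinLSM.IsCoordLocal (fun x : RectTorusSite Ls => x i) (rectTorusInteraction Φ Ls)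
      (⌊R⌋₊ + 1) ((2 * ⌊R⌋₊ + 1) ^ d) (2 ^ d * 2 ^ ((2 * ⌊R⌋₊ + 1) ^ d) * J) where
  isLocal := rectTorusInteraction_isLocal_holds hH Ls
  range := fun _ hZ _ hx _ hy =>
    (circDist_le_of_rectTorusInteraction_ne_zero Ls hR hZ hx hy i).trans (Nat.le_succ _)
  strength_nonneg := mul_nonneg (by positivity) ((norm_nonneg _).trans (hJ ∅))
  strength := fun x => sum_norm_rectTorusInteraction_le Ls hR hJ x
  one_le_size := Nat.one_le_pow _ _ (by omega)
  size := fun _ hZ => card_le_of_rectTorusInteraction_ne_zero Ls hR hZ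
  empty := rectTorusInteraction_empty Ls Φ

/-- **`U(1)` symmetry of the torus terms**: for a rotation-invariant spin-`1/2` interaction every
term `(rectTorusInteraction Φ Ls) Y` commutes with the charge `Q_Y = Σ_{y ∈ Y} (Sᶻ_y + ½)` of its
region (each wrapped term is a rotation-invariant element of `𝔄_Y`, which commutes with the total
`z`-spin of `Y`). Nachtergaele–Sims (2007) §1.2 (LSM3); Bachmann–Bols–De Roeck–Fraas (2019) §2.1.4.
[folklore] -/
theorem commute_rectTorusInteraction_regionCharge {Φ : LatticeInteraction d 2}
    (hrot : Φ.IsRotationInvariant) (Y : Finset (RectTorusSite Ls)) :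
    Commute (rectTorusInteraction Φ Ls Y) (regionCharge Y) := by
  rw [rectTorusInteraction_eq_sum]
  refine Commute.sum_left _ _ _ fun X hX => ?_
  rw [Finset.mem_filter, mem_wrapRepSet] at hX
  obtain ⟨hrep, rfl⟩ := hX
  obtain ⟨e, he⟩ := exists_equiv_image Ls X (injOn_proj_of_isWrapRepresentative hrep)
  rw [wrapTerm_eq_localOp_reindexOp Ls X e he, regionCharge_eq_sum_siteSpin_add]
  refine Commute.add_right ?_ ((Commute.one_right _).smul_right _)
  rw [← Finset.sum_coe_sort (X.image (RectTorus.proj Ls)), ← localOp_totalSpin]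
  have hB : ∀ β, Commute (reindexOp e (Φ X))
      (totalSpin (Λ := ↥(X.image (RectTorus.proj Ls))) 1 β) := by
    intro β
    have h := (commute_totalSpin_of_forall_commute_globalRotation (fun θ => hrot θ X) β).map
      (reindexOp (q := 2) e)
    rwa [reindexOp_totalSpin] at h
  show localOp _ _ * localOp _ _ = localOp _ _ * localOp _ _
  rw [← localOp_mul_holds, (hB 2).eq, localOp_mul_holds]

/-- **Translation symmetry of the torus Hamiltonian** as commutation with the permutation unitary
of the translation by `proj v`: `P_v H_𝕋 = H_𝕋 P_v`. Nachtergaele–Sims (2007) §1.2 (LSM2). [folklore] -/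
theorem permOp_addRight_mul_rectTorusHamiltonian {Φ : LatticeInteraction d q}
    (hT : Φ.IsTranslationInvariant) (v : Site d) :
    permOp (Equiv.addRight (RectTorus.proj Ls v)) * rectTorusHamiltonian Φ Ls =
      rectTorusHamiltonian Φ Ls * permOp (Equiv.addRight (RectTorus.proj Ls v)) :=
  (permOp_mul_eq_mul_permOp_iff _ _).2 (reindexOp_addRight_rectTorusHamiltonian Ls hT v)

end Terms

end Literature.MathematicalPhysics.QuantumLattice

end
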